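import Literature.AlgebraicGeometry.GroupSchemes.AffineGroupSchemeBaseChangeAlg
import Literature.AlgebraicGeometry.GroupSchemes.AffineGroupSchemeHopfAlgebraRoundTrip
import Mathlib.RingTheory.Bialgebra.TensorProduct
import Mathlib.RingTheory.Bialgebra.Equiv
import HarnessLib

/-!
# `Γ(G_{R′}, 𝒪) ≃ R′ ⊗_R Γ(G, 𝒪)` is an isomorphism of HOPF algebras (Görtz–Wedhorn II §(27.2); Tate 1997 §(3.8) «`(A_B)` base change»)

Layer `Literature/AlgebraicGeometry/GroupSchemes`, namespace `Literature.AlgebraicGeometry.GroupSchemes.AffineGroupScheme` (continues ★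
`AffineGroupSchemeBaseChangeAlg` — `algBaseChangeEquiv R′ G : Alg G_{R′} ≃ₐ[R′] R′ ⊗[R] Alg G`, `toAlgBaseChange`, `algHomEquivBaseChange_eq` —, ★
`AffineGroupSchemeBaseChangePoints` p844891 ∕ p845023 — `algHomEquivBaseChange_mul ∕ _one ∕ _comp` — and ★ `AffineGroupSchemeHopfAlgebraRoundTrip`
p845217 — `comulAlgHom_alg_eq ∕ counitAlgHom_alg_eq`).  One `def` (the bialgebra equivalence `algBaseChangeBialgEquiv`) + theorems; no instance,
no notation, no named fact, no `sorry`.  Cell `hodgecm-mathlib` (D-0151), programme P6 «MOD», HEART organ GAP-1b (Hopf form) = rider (b) step 2 of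
B-p04 (g37) (input of the base change of the Cartier dual `(G_{R′})^D ≅ (G^D)_{R′}`).  Count-neutral Mathlib-side capital: HC_CM is proved only modulo
the 7 printed citations until rung 0 closes; nothing here bears on it.

THE PRINT ([GortzWedhorn2023] §(27.2): the Hopf algebra of `G ×_R R′` is the base-changed Hopf algebra `R′ ⊗_R Γ(G)`; [Tate1997FiniteFlatGroupSchemes]
§(3.8) p. 145 «`A_B = A ⊗_R B`»).  Mathlib equips `R′ ⊗[R] Γ(G)` with the base-change bialgebra ∕ Hopf structure (`TensorProduct.instBialgebra`:
`Δ(r ⊗ a) = Σ (r ⊗ a₁) ⊗ (1 ⊗ a₂)`, `ε(r ⊗ a) = ε(a) r`); THIS FILE proves that ★ `algBaseChangeEquiv` matches it with the Hopf structure ★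
`Alg.instHopfAlgebra` of the base-changed group scheme `G_{R′}` (Mathlib's transported group object `Functor.grpObjObj`):

* §1 `algHom_ext_toAlgBaseChange` (two `R′`-algebra maps out of `Γ(G_{R′})` agree iff they agree on `Γ(G)` — Yoneda);
* §2 **`counitAlgHom_comp_algBaseChangeEquiv`** (`ε′ ∘ e = ε`), via ★ `algHomEquivBaseChange_one` and Mathlib `counit_tmul`;
* §3 **`map_algBaseChangeEquiv_comp_comulAlgHom`** (`(e ⊗ e) ∘ Δ = Δ′ ∘ e`), via ★ `algHomEquivBaseChange_mul`, ★ `CorepGroupLaw.mul_eq` and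
  Mathlib `comul_tmul` ∕ `tensorTensorTensorComm_tmul`;
* §4 HEAD **`algBaseChangeBialgEquiv R′ G : Alg G_{R′} ≃ₐc[R′] R′ ⊗[R] Alg G`** (Mathlib `BialgEquiv.ofAlgEquiv`).

## References
* [GortzWedhorn2023] U. Görtz, T. Wedhorn, *Algebraic Geometry II* (2023), §(27.2), (27.2.1), Def. 27.6 (pp. 606–607).
* [Tate1997FiniteFlatGroupSchemes] J. Tate, *Finite flat group schemes* (1997), §(3.8) p. 145.
-/

set_option autoImplicit false

-- Mathlib's `Over`/`Scheme` APIs are stated across semireducible wrappers (as in the ★ `GroupSchemes/*` files).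
set_option backward.isDefEq.respectTransparency false

universe u

open CategoryTheory CategoryTheory.Limits AlgebraicGeometry MonoidalCategory CartesianMonoidalCategory TensorProduct WithConv

noncomputable section

namespace Literature.AlgebraicGeometry.GroupSchemes

namespace AffineGroupScheme

open scoped MonObj CategoryTheory.Obj

open Literature.AlgebraicGeometry.Motives Literature.NumberTheory.DiophantineGeometry

variable {R : Type u} [CommRing R] (R' : Type u) [CommRing R'] [Algebra R R'] (G : SchemeOver R) [GrpObj G] [IsAffine G.left]
  [IsAffine ((Over.pullback (Spec.map (CommRingCat.ofHom (algebraMap R R')))).obj G).left]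

/-! ## §1 Yoneda: maps out of `Γ(G_{R′})` are determined on `Γ(G)` -/

/-- **Two `R′`-algebra maps out of `Γ(G_{R′})` agree iff they agree after `Γ(G) → Γ(G_{R′})`** (★ `algHomEquivBaseChange` is injective and
`algHomEquivBaseChange φ = φ|_R ∘ toAlgBaseChange`). [cite: GortzWedhorn2023, §(27.2) (pp. 606–607)] -/
theorem algHom_ext_toAlgBaseChange {R'' : Type u} [CommRing R''] [Algebra R R''] [Algebra R' R''] [IsScalarTower R R' R'']
    {ψ₁ ψ₂ : Alg ((Over.pullback (Spec.map (CommRingCat.ofHom (algebraMap R R')))).obj G) →ₐ[R'] R''}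
    (h : (ψ₁.restrictScalars R).comp (toAlgBaseChange R' G) = (ψ₂.restrictScalars R).comp (toAlgBaseChange R' G)) : ψ₁ = ψ₂ := by
  apply (algHomEquivBaseChange R' R'' G).injective
  rw [algHomEquivBaseChange_eq, algHomEquivBaseChange_eq, h]

/-! ## §2 The counits -/

/-- **`ε_{R′ ⊗ Γ(G)} ∘ e = ε_{Γ(G_{R′})}`**: the counit of `Γ(G_{R′})` is the unit point (★ `counitAlgHom_alg_eq`), which ★ `algHomEquivBaseChange_one`
carries to the unit point of `Γ(G)`, i.e. to `a ↦ ε(a) · 1 = ε′(1 ⊗ a)` (Mathlib `counit_tmul`). [cite: GortzWedhorn2023, §(27.2) (27.2.1) (pp. 606–607)] -/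
theorem counitAlgHom_comp_algBaseChangeEquiv :
    (Bialgebra.counitAlgHom R' (R' ⊗[R] Alg G)).comp (algBaseChangeEquiv R' G).toAlgHom =
      Bialgebra.counitAlgHom R' (Alg ((Over.pullback (Spec.map (CommRingCat.ofHom (algebraMap R R')))).obj G)) := by
  apply algHom_ext_toAlgBaseChange R' G
  have hR : ((Bialgebra.counitAlgHom R'
      (Alg ((Over.pullback (Spec.map (CommRingCat.ofHom (algebraMap R R')))).obj G))).restrictScalars R).comp (toAlgBaseChange R' G) =
      (Algebra.ofId R R').comp (Bialgebra.counitAlgHom R (Alg G)) := by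
    rw [← algHomEquivBaseChange_eq, counitAlgHom_alg_eq, counitAlgHom_alg_eq, CorepGroupLaw.counit, CorepGroupLaw.counit,
      algHomEquivBaseChange_one, CorepGroupLaw.one_eq]
    rfl
  rw [hR]
  ext a
  have h := AlgHom.congr_fun (algBaseChangeHom_comp_toAlgBaseChange R' G) a
  simp only [AlgHom.coe_comp, AlgHom.coe_restrictScalars', Function.comp_apply, Algebra.TensorProduct.includeRight_apply] at h
  change Bialgebra.counitAlgHom R' (R' ⊗[R] Alg G) (algBaseChangeHom R' G (toAlgBaseChange R' G a)) =
    algebraMap R R' (Bialgebra.counitAlgHom R (Alg G) a)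
  rw [h, Bialgebra.counitAlgHom_apply, Bialgebra.counitAlgHom_apply, TensorProduct.counit_tmul, CommSemiring.counit_apply,
    Algebra.smul_def, mul_one]

/-! ## §3 The comultiplications -/

/-- The two ways `Γ(G) ⊗_R Γ(G) → (R′ ⊗ Γ(G)) ⊗_{R′} (R′ ⊗ Γ(G))` agree: `(e ⊗ e) (ι₁(t x) · ι₂(t y)) = (1 ⊗ x) ⊗ (1 ⊗ y) = τ((1 ⊗ 1) ⊗ (x ⊗ y))`
(`t = toAlgBaseChange`, `τ` = Mathlib `tensorTensorTensorComm`). [cite: GortzWedhorn2023, §(27.2) (27.2.1) (pp. 606–607)] -/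
theorem map_algBaseChangeEquiv_lift_eq (z : Alg G ⊗[R] Alg G) :
    Algebra.TensorProduct.map (algBaseChangeEquiv R' G).toAlgHom (algBaseChangeEquiv R' G).toAlgHom
        (Algebra.TensorProduct.lift
          (((Algebra.TensorProduct.includeLeft :
              Alg ((Over.pullback (Spec.map (CommRingCat.ofHom (algebraMap R R')))).obj G) →ₐ[R']
                Alg ((Over.pullback (Spec.map (CommRingCat.ofHom (algebraMap R R')))).obj G) ⊗[R']
                  Alg ((Over.pullback (Spec.map (CommRingCat.ofHom (algebraMap R R')))).obj G)).restrictScalars R).comp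
            (toAlgBaseChange R' G))
          (((Algebra.TensorProduct.includeRight :
              Alg ((Over.pullback (Spec.map (CommRingCat.ofHom (algebraMap R R')))).obj G) →ₐ[R']
                Alg ((Over.pullback (Spec.map (CommRingCat.ofHom (algebraMap R R')))).obj G) ⊗[R']
                  Alg ((Over.pullback (Spec.map (CommRingCat.ofHom (algebraMap R R')))).obj G)).restrictScalars R).comp
            (toAlgBaseChange R' G))
          (fun _ _ => .all _ _) z) =
      Algebra.TensorProduct.tensorTensorTensorComm R R' R R' R' R' (Alg G) (Alg G) (((1 : R') ⊗ₜ[R'] (1 : R')) ⊗ₜ[R] z) := by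
  induction z using TensorProduct.induction_on with
  | zero => simp
  | tmul x y =>
      rw [Algebra.TensorProduct.lift_tmul, map_mul, Algebra.TensorProduct.tensorTensorTensorComm_tmul]
      simp only [AlgHom.coe_comp, AlgHom.coe_restrictScalars', Function.comp_apply, Algebra.TensorProduct.includeLeft_apply,
        Algebra.TensorProduct.includeRight_apply, Algebra.TensorProduct.map_tmul, map_one, AlgEquiv.coe_toAlgHom,
        algBaseChangeEquiv_toAlgBaseChange, Algebra.TensorProduct.tmul_mul_tmul, one_mul, mul_one]
  | add x y hx hy => rw [map_add, map_add, hx, hy, TensorProduct.tmul_add, map_add]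

/-- **`(e ⊗ e) ∘ Δ_{Γ(G_{R′})} = Δ_{R′ ⊗ Γ(G)} ∘ e`**: `e := algBaseChangeEquiv` commutes with the comultiplications.  LEFT: `Δ_{Γ(G_{R′})} = p₁ · p₂`
(★ `comulAlgHom_alg_eq`), carried by ★ `algHomEquivBaseChange_mul` to `(p₁|_R ∘ t) · (p₂|_R ∘ t) = lift(…) ∘ Δ_{Γ(G)}` (★ `CorepGroupLaw.mul_eq`);
RIGHT: `Δ′(1 ⊗ a) = τ((1 ⊗ 1) ⊗ Δ a)` (Mathlib `comul_tmul`); they agree by `map_algBaseChangeEquiv_lift_eq`.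
[cite: GortzWedhorn2023, §(27.2) (27.2.1) (pp. 606–607)] -/
theorem map_algBaseChangeEquiv_comp_comulAlgHom :
    (Algebra.TensorProduct.map (algBaseChangeEquiv R' G).toAlgHom (algBaseChangeEquiv R' G).toAlgHom).comp
        (Bialgebra.comulAlgHom R' (Alg ((Over.pullback (Spec.map (CommRingCat.ofHom (algebraMap R R')))).obj G))) =
      (Bialgebra.comulAlgHom R' (R' ⊗[R] Alg G)).comp (algBaseChangeEquiv R' G).toAlgHom := by
  apply algHom_ext_toAlgBaseChange R' G
  -- the left-hand side, read on `Γ(G)`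
  have hL : (((Algebra.TensorProduct.map (algBaseChangeEquiv R' G).toAlgHom (algBaseChangeEquiv R' G).toAlgHom).comp
      (Bialgebra.comulAlgHom R' (Alg ((Over.pullback (Spec.map (CommRingCat.ofHom (algebraMap R R')))).obj G)))).restrictScalars R).comp
        (toAlgBaseChange R' G) =
      ((Algebra.TensorProduct.map (algBaseChangeEquiv R' G).toAlgHom (algBaseChangeEquiv R' G).toAlgHom).restrictScalars R).comp
        ((Algebra.TensorProduct.lift
          (((Algebra.TensorProduct.includeLeft :
              Alg ((Over.pullback (Spec.map (CommRingCat.ofHom (algebraMap R R')))).obj G) →ₐ[R']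
                Alg ((Over.pullback (Spec.map (CommRingCat.ofHom (algebraMap R R')))).obj G) ⊗[R']
                  Alg ((Over.pullback (Spec.map (CommRingCat.ofHom (algebraMap R R')))).obj G)).restrictScalars R).comp
            (toAlgBaseChange R' G))
          (((Algebra.TensorProduct.includeRight :
              Alg ((Over.pullback (Spec.map (CommRingCat.ofHom (algebraMap R R')))).obj G) →ₐ[R']
                Alg ((Over.pullback (Spec.map (CommRingCat.ofHom (algebraMap R R')))).obj G) ⊗[R']
                  Alg ((Over.pullback (Spec.map (CommRingCat.ofHom (algebraMap R R')))).obj G)).restrictScalars R).comp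
            (toAlgBaseChange R' G))
          (fun _ _ => .all _ _)).comp (Bialgebra.comulAlgHom R (Alg G))) := by
    rw [← algHomEquivBaseChange_eq, algHomEquivBaseChange_comp, comulAlgHom_alg_eq, comulAlgHom_alg_eq, CorepGroupLaw.comul_def,
      algHomEquivBaseChange_mul, CorepGroupLaw.mul_eq, algHomEquivBaseChange_eq, algHomEquivBaseChange_eq]
  rw [hL]
  ext a
  simp only [AlgHom.coe_comp, AlgHom.coe_restrictScalars', Function.comp_apply]
  rw [map_algBaseChangeEquiv_lift_eq, AlgEquiv.coe_toAlgHom, algBaseChangeEquiv_toAlgBaseChange, Bialgebra.TensorProduct.comulAlgHom_def,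
    AlgHom.comp_apply, Algebra.TensorProduct.map_tmul, map_one, Algebra.TensorProduct.one_def]
  rfl

/-! ## §4 The Hopf-algebra isomorphism -/

/-- **HEAD — `Γ(G_{R′}, 𝒪) ≃ₐc[R′] R′ ⊗_R Γ(G, 𝒪)` as BIALGEBRAS**: the Hopf algebra of the base-changed group scheme `G_{R′}` (Mathlib's transported
group object, ★ `Alg.instHopfAlgebra`) is the base-changed Hopf algebra (Mathlib `TensorProduct.instBialgebra`) — [GortzWedhorn2023] §(27.2);
[Tate1997FiniteFlatGroupSchemes] §(3.8) «`A_B`». [cite: GortzWedhorn2023, §(27.2) (27.2.1) and Definition 27.6 (pp. 606–607)] -/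
def algBaseChangeBialgEquiv : Alg ((Over.pullback (Spec.map (CommRingCat.ofHom (algebraMap R R')))).obj G) ≃ₐc[R'] R' ⊗[R] Alg G :=
  BialgEquiv.ofAlgEquiv (algBaseChangeEquiv R' G) (counitAlgHom_comp_algBaseChangeEquiv R' G) (map_algBaseChangeEquiv_comp_comulAlgHom R' G)

/-- `algBaseChangeBialgEquiv` is `algBaseChangeEquiv` on elements. [cite: GortzWedhorn2023, §(27.2) (p. 606)] -/
theorem algBaseChangeBialgEquiv_apply (x : Alg ((Over.pullback (Spec.map (CommRingCat.ofHom (algebraMap R R')))).obj G)) :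
    algBaseChangeBialgEquiv R' G x = algBaseChangeEquiv R' G x := rfl

end AffineGroupScheme

end Literature.AlgebraicGeometry.GroupSchemes

end
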